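import Summits.BirchSwinnertonDyer.BirchSwinnertonDyer.Theorems.ByReductionTypeAtTwoSupersingularFlatKernelCyclicOfPairing
import Literature.NumberTheory.EllipticCurves.IwasawaSelmerDualUniquenessProofs
import HarnessLib

/-!
# Route `ByReductionTypeAtTwo` (rung K4), crux `SupersingularRankZeroAtTwo` (item stmt-BirchSwinnertonDyer-19097), line
# `odd_blind_package` v2.13 (04fc80b988a3bb5c), stub `stub_flatKernelCyclic : FlatKernelCyclicHondaAtTwo` (hand h13), sub-hand
# h13b (hC-glob-arith): **the kernel of `X ↠ X^•` is cyclic as soon as the Pontryagin dual of the ONE discrete group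
# `Sel_{p^∞}(E/K_∞) / Sel^•(E/K_∞)` is a cyclic `Λ`-module** — the dual pair `(Y, Q)` and the map `Φ` of the LEAD's
# `exists_ker_eq_span_singleton_of_pairing` (p823268) CONSTRUCTED canonically (`Q = Sel/Sel^•`, `Φ` = the quotient map,
# `Y = Hom(Q, ℚ/ℤ)` with the tree's `Λ`-structure `IwasawaDual.IsLocNil.module`), pure algebra
# (cell `bsd-2adic`, seat `bsd-2adic-t42` GEN 44, hand h13 of `wake/SUMMON-bsd-2adic-t42-20260831T124134Z.md`; `--supports 19097`, helper)

HONEST FRAMING (D-0036/D-0054): THEOREMS ONLY (no definition, no named fact, no `sorry`, no instance).  Nothing about any curve is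
computed.  WHAT THIS BUYS: the displayed input of (hC-glob) shrinks from the ten binders `(Y, Q, ψ_Q, toDual_Q, hY, y₀, hy₀, Φ, hΦ,
hkerΦ)` of p823268 to ONE canonical proposition about ONE canonical object — «`Hom(Sel_∞/Sel^•, ℚ/ℤ)` is a cyclic `Λ`-module»
(`T` acting through `conj_γ − 1`).  That proposition is Kitajima–Otsuki's (4.2) + Prop. 3.32 read for Sprung's `♭` at `p = 2`:
`(Sel/Sel♭)^∨` is a quotient of `(H¹(k_∞, E[p^∞])/E♭_∞)^∨ ≅ Ker Col♭ ≅ Λ` (one place of `ℚ_∞` over `2`, `[ℚ₂ : ℚ₂] = 1`); it is the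
honest residual of h13b (the Kummer pairing against `z♭`) and is NOT proved here.  19097 OPEN; nothing booked; BSD proved for no curve.

* §1 (generic `Λ`-duality algebra) `isLocNil_of_surjective` — a surjection `Φ : S ↠ Q` with `Φ ∘ ψ = ψ_Q ∘ Φ` transports local
  nilpotence; `isDualPair_characterModule` — for `(Q, ψ_Q)` locally nilpotent, `(Hom(Q, ℚ/ℤ), Q, ψ_Q, id)` IS a dual pair
  (`IwasawaDual.IsDualPair`) for the `Λ`-structure `IsLocNil.module` (the construction of `WeierstrassCurve.selmerDualData`, abstracted).
* §2 `exists_ker_eq_span_singleton_of_surjective_of_cyclic` — p823268 with `(Y, Q)` := the character pair of ANY `(conj_γ − 1)`-equivariant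
  surjection `Φ : Sel_∞ ↠ Q` with kernel `Sel^•`: `ker π = Λ ∙ x₀` as soon as `Hom(Q, ℚ/ℤ)` is cyclic.
* §3 **`exists_ker_eq_span_singleton_of_cyclic_quotientDual`** — the canonical instance `Q := Sel_∞ ⧸ Sel^•` (Mathlib quotient by
  `(Sel^•).addSubgroupOf Sel_∞`; `conj_γ − 1` descends by `conjH1_mem_sharpFlatSelmerInfty`): **`ker(X ↠ X^•) = Λ ∙ x₀` if
  `Hom(Sel_∞/Sel^•, ℚ/ℤ)` is cyclic** — any number field `K`, any `p`, any chroma `•`, any key.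
* §4 `flatKernelCyclic_honda_two_of_cyclic_quotientDual` — the registered h13 shape `FlatKernelCyclicHondaAtTwo` (v2.13 stub 5, LEAD memo
  `HAND-TARGETS-NF-1.md` §2 VERBATIM) from the ONE displayed family `hcyc` (per `W κ γ v g c`: `Hom(Sel_∞/Sel♭, ℚ/ℤ)` cyclic); every
  other binder of the stub (GoodSS, torsion of `X♭`, the Honda clause, …) is then idle — the cyclicity of the kernel is a statement about
  `Sel_∞/Sel♭` alone.

References: [KitajimaOtsuki2018] (4.2), Prop. 3.32 (arXiv:1607.03612 pp. 16–19); [GreenbergLNM1716] §1 p. 60 (the `Λ`-action on duals);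
[Sprung2012] Def. 7.9, 7.11; [Lang1990] Ch. 5 §1; tree p823268 (LEAD ss-1 GEN 23), `IwasawaDualModule`, `IwasawaSelmerDualProofs`.
-/

set_option autoImplicit false
-- the Theorems namespace of this sub repeats the summit name by design (D-0017 nested layout)
set_option linter.dupNamespace false

noncomputable section

open scoped Classical

namespace Summit.BirchSwinnertonDyer.BirchSwinnertonDyer.Theorems

namespace OddBlindNF

open Literature.NumberTheory.EllipticCurves Literature.NumberTheory.EllipticCurves.IwasawaDual

/-! ### §1 Character pairs: `(Hom(Q, ℚ/ℤ), Q)` is a dual pair for every locally nilpotent `(Q, ψ_Q)` -/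

section CharacterPair

variable {p : ℕ} [Fact p.Prime]

omit [Fact p.Prime] in
/-- **Local nilpotence descends along equivariant surjections**: if every element of `S` is killed by a power of `p` and by a power
of `ψ`, and `Φ : S ↠ Q` is additive with `Φ ∘ ψ = ψ_Q ∘ Φ`, then the same holds for `(Q, ψ_Q)`. [folklore]
[cite: GreenbergLNM1716, §1 p. 60 (after Conj. 1.3)] -/
theorem isLocNil_of_surjective {S : Type*} [AddCommGroup S] {ψ : AddMonoid.End S} {Q : Type*} [AddCommGroup Q]
    {ψQ : AddMonoid.End Q} (h : IsLocNil p ψ) (Φ : S →+ Q) (hsurj : Function.Surjective Φ)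
    (hΦ : ∀ s, Φ (ψ s) = ψQ (Φ s)) : IsLocNil p ψQ := by
  have hpow : ∀ (N : ℕ) (s : S), Φ ((ψ ^ N) s) = (ψQ ^ N) (Φ s) := by
    intro N
    induction N with
    | zero => intro s; rfl
    | succ N ih =>
      intro s
      rw [pow_succ, pow_succ, AddMonoid.End.coe_mul, AddMonoid.End.coe_mul, Function.comp_apply,
        Function.comp_apply, ih, hΦ]
  refine ⟨fun q ↦ ?_, fun q ↦ ?_⟩
  · obtain ⟨s, rfl⟩ := hsurj q
    obtain ⟨k, hk⟩ := h.torsion s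
    exact ⟨k, by rw [← map_nsmul, hk, map_zero]⟩
  · obtain ⟨s, rfl⟩ := hsurj q
    obtain ⟨N, hN⟩ := h.nil s
    exact ⟨N, by rw [← hpow, hN, map_zero]⟩

/-- **The character pair of a locally nilpotent `(Q, ψ_Q)` is a dual pair**: `Y := Hom(Q, ℚ/ℤ)` with the `Λ = ℤ_p⟦T⟧`-structure
`IsLocNil.module` (`T` acts as `y ↦ y ∘ ψ_Q`, constants through `ℤ_p → ℤ/p^k`) and `toDual := id` satisfy `IwasawaDual.IsDualPair`
— the construction of `WeierstrassCurve.selmerDualData` for an abstract `(Q, ψ_Q)`. [cite: GreenbergLNM1716, §1 p. 60 (after Conj. 1.3)]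
[cite: Lang1990, Ch. 5 §1] -/
theorem isDualPair_characterModule {Q : Type*} [AddCommGroup Q] {ψQ : AddMonoid.End Q} (hQ : IsLocNil p ψQ) :
    letI := hQ.module (A := AddCircle (1 : ℚ)); IsDualPair p ψQ (AddMonoidHom.id (Q →+ AddCircle (1 : ℚ))) := by
  letI := hQ.module (A := AddCircle (1 : ℚ))
  refine ⟨Function.bijective_id, fun x s ↦ ?_, fun c x s k hk ↦ ?_, hQ⟩
  · show hQ.smulFun PowerSeries.X x s = x (ψQ s)
    exact hQ.smulFun_X_apply x s
  · show hQ.smulFun (PowerSeries.C c) x s = (PadicInt.toZModPow k c).val • x s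
    exact hQ.smulFun_C_apply c x hk

end CharacterPair

/-! ### §2 p823268 with the character pair of an equivariant surjection `Sel_∞ ↠ Q` with kernel `Sel^•` -/

section Selmer

open NumberField IsDedekindDomain WeierstrassCurve Literature.NumberTheory.EllipticCurves.Sprung2017
  Literature.NumberTheory.EllipticCurves.Sprung2012 Literature.NumberTheory.GaloisRepresentations ZpExtension

universe u

variable {K : Type u} [Field K] [NumberField K] {W : WeierstrassCurve K} {p : ℕ} [Fact p.Prime] {κ : ZpExtension K p}
  {γ : Field.absoluteGaloisGroup K} {E : Type u} [Field E] [Algebra K E] {ι : AlgebraicClosure K →ₐ[K] AlgebraicClosure E}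
  {ap : ℤ} {g : Field.absoluteGaloisGroup E} {c : ℕ → localPoints W E} {col : Chroma}

/-- **`ker(X ↠ X^•) = Λ ∙ x₀` from ONE cyclicity.**  Let `S`, `D`, `π`, `hpin` be as in `exists_ker_eq_span_singleton_of_pairing`
(the classical dual, a `•`-dual datum in the same key `γ`, the pinned surjection).  For ANY additive surjection `Φ : Sel_{p^∞}(E/K_∞) ↠ Q`
with `Φ ∘ (conj_γ − 1) = ψ_Q ∘ Φ` and kernel exactly `Sel^•`: if the `Λ`-module `Hom(Q, ℚ/ℤ)` (structure `IsLocNil.module`, `T ↦ ∘ ψ_Q`;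
local nilpotence of `(Q, ψ_Q)` is inherited from `Sel_∞`, `isLocNil_conjSelmerInfty_sub_one'`) is CYCLIC, then `ker π` is cyclic.
[cite: KitajimaOtsuki2018, (4.2) and Prop. 3.32 (arXiv:1607.03612 pp. 16, 19)] [cite: Sprung2012, Def. 7.9, Def. 7.11] -/
theorem exists_ker_eq_span_singleton_of_surjective_of_cyclic (S : W.SelmerDualData κ γ)
    (D : SharpFlatSelmerDualData W κ γ ι ap g c col) (π : S.X →ₗ[IwasawaAlgebra p] D.X)
    (hpin : ∀ (x : S.X) (s : sharpFlatSelmerInfty W κ ι ap g c col),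
      D.toDual (π x) s = S.toDual x (AddSubgroup.inclusion (sharpFlatSelmerInfty_le_selmerInfty W κ ι ap g c col) s))
    {Q : Type*} [AddCommGroup Q] (ψQ : AddMonoid.End Q) (Φ : W.selmerInfty κ →+ Q) (hsurj : Function.Surjective Φ)
    (hΦ : ∀ s, Φ ((W.conjSelmerInfty κ γ - 1) s) = ψQ (Φ s))
    (hkerΦ : ∀ s : W.selmerInfty κ, Φ s = 0 ↔ (s : W.subgroupH1 p κ.kerSubgroup) ∈ sharpFlatSelmerInfty W κ ι ap g c col)
    (hcyc : letI := (isLocNil_of_surjective (W.isLocNil_conjSelmerInfty_sub_one' κ γ) Φ hsurj hΦ).module (A := AddCircle (1 : ℚ));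
      ∃ y₀ : Q →+ AddCircle (1 : ℚ), ∀ y : Q →+ AddCircle (1 : ℚ), ∃ f : IwasawaAlgebra p, f • y₀ = y) :
    ∃ x₀ : S.X, LinearMap.ker π = Submodule.span (IwasawaAlgebra p) {x₀} := by
  letI := (isLocNil_of_surjective (W.isLocNil_conjSelmerInfty_sub_one' κ γ) Φ hsurj hΦ).module (A := AddCircle (1 : ℚ))
  obtain ⟨y₀, hy₀⟩ := hcyc
  exact exists_ker_eq_span_singleton_of_pairing S D π hpin
    (isDualPair_characterModule (isLocNil_of_surjective (W.isLocNil_conjSelmerInfty_sub_one' κ γ) Φ hsurj hΦ)) y₀ hy₀ Φ hΦ hkerΦ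

/-! ### §3 The canonical instance: `Q := Sel_∞ ⧸ Sel^•` -/

/-- `Sel^•` as a subgroup of `Sel_∞` is stable under `conj_γ − 1` (both are `conj_γ`-stable). [cite: Sprung2012, Def. 7.11 (p. 1503)] -/
theorem sharpFlat_addSubgroupOf_le_comap_conjSelmerInfty_sub_one (γ : Field.absoluteGaloisGroup K) :
    (sharpFlatSelmerInfty W κ ι ap g c col).addSubgroupOf (W.selmerInfty κ) ≤
      ((sharpFlatSelmerInfty W κ ι ap g c col).addSubgroupOf (W.selmerInfty κ)).comap
        (W.conjSelmerInfty κ γ - 1 : AddMonoid.End (W.selmerInfty κ)) := by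
  intro s hs
  rw [AddSubgroup.mem_comap, AddSubgroup.mem_addSubgroupOf]
  rw [AddSubgroup.mem_addSubgroupOf] at hs
  -- `↑((conj_γ − 1) s) = conj_γ ↑s − ↑s` definitionally
  exact sub_mem (conjH1_mem_sharpFlatSelmerInfty W κ ι ap g c col γ hs) hs

/-- `conj_γ − 1` descended to `Sel_∞ ⧸ Sel^•` is locally nilpotent together with `p` (inherited from `Sel_∞`,
`isLocNil_conjSelmerInfty_sub_one'`). [cite: GreenbergLNM1716, §1 p. 60 (after Conj. 1.3)] -/
theorem isLocNil_quotient_sharpFlat (γ : Field.absoluteGaloisGroup K) :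
    IsLocNil p (QuotientAddGroup.map _ _ (W.conjSelmerInfty κ γ - 1 : AddMonoid.End (W.selmerInfty κ))
      (sharpFlat_addSubgroupOf_le_comap_conjSelmerInfty_sub_one (W := W) (κ := κ) (ι := ι) (ap := ap) (g := g)
        (c := c) (col := col) γ) :
        AddMonoid.End (W.selmerInfty κ ⧸ (sharpFlatSelmerInfty W κ ι ap g c col).addSubgroupOf (W.selmerInfty κ))) :=
  isLocNil_of_surjective (W.isLocNil_conjSelmerInfty_sub_one' κ γ) (QuotientAddGroup.mk' _)
    (QuotientAddGroup.mk'_surjective _)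
    (fun s ↦ (QuotientAddGroup.map_mk' _ _ _ (sharpFlat_addSubgroupOf_le_comap_conjSelmerInfty_sub_one γ) s).symm)

/-- **(hC-glob) canonical form: `ker(X ↠ X^•) = Λ ∙ x₀` if `Hom(Sel_∞ ⧸ Sel^•, ℚ/ℤ)` is a cyclic `Λ`-module.**  `Q := Sel_∞ ⧸ Sel^•`
(`QuotientAddGroup` by `(Sel^•).addSubgroupOf Sel_∞`), `ψ_Q :=` the endomorphism induced by `conj_γ − 1` (`QuotientAddGroup.map`),
`Y := Hom(Q, ℚ/ℤ)` with `IsLocNil.module` (`isLocNil_quotient_sharpFlat`); the hypothesis is the cyclicity of `Y` and nothing else —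
Kitajima–Otsuki's «`(Sel/Sel^•)^∨` is a quotient of `(H¹(k_∞)/E^•_∞)^∨ ≅ Λ`» as the ONE displayed input of h13b. Any `K`, `p`, chroma, key.
[cite: KitajimaOtsuki2018, (4.2) and Prop. 3.32 (arXiv:1607.03612 pp. 16, 19)] [cite: Sprung2012, Def. 7.9, Def. 7.11] -/
theorem exists_ker_eq_span_singleton_of_cyclic_quotientDual (S : W.SelmerDualData κ γ)
    (D : SharpFlatSelmerDualData W κ γ ι ap g c col) (π : S.X →ₗ[IwasawaAlgebra p] D.X)
    (hpin : ∀ (x : S.X) (s : sharpFlatSelmerInfty W κ ι ap g c col),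
      D.toDual (π x) s = S.toDual x (AddSubgroup.inclusion (sharpFlatSelmerInfty_le_selmerInfty W κ ι ap g c col) s))
    (hcyc :
      letI := (isLocNil_quotient_sharpFlat (W := W) (κ := κ) (ι := ι) (ap := ap) (g := g) (c := c) (col := col) γ).module (A := AddCircle (1 : ℚ));
      ∃ y₀ : W.selmerInfty κ ⧸ (sharpFlatSelmerInfty W κ ι ap g c col).addSubgroupOf (W.selmerInfty κ) →+ AddCircle (1 : ℚ),
        ∀ y, ∃ f : IwasawaAlgebra p, f • y₀ = y) :
    ∃ x₀ : S.X, LinearMap.ker π = Submodule.span (IwasawaAlgebra p) {x₀} :=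
  exists_ker_eq_span_singleton_of_surjective_of_cyclic S D π hpin
    (QuotientAddGroup.map _ _ (W.conjSelmerInfty κ γ - 1 : AddMonoid.End (W.selmerInfty κ))
      (sharpFlat_addSubgroupOf_le_comap_conjSelmerInfty_sub_one γ))
    (QuotientAddGroup.mk' _) (QuotientAddGroup.mk'_surjective _)
    (fun s ↦ (QuotientAddGroup.map_mk' _ _ _ (sharpFlat_addSubgroupOf_le_comap_conjSelmerInfty_sub_one γ) s).symm)
    (fun s ↦ by rw [QuotientAddGroup.mk'_apply, QuotientAddGroup.eq_zero_iff, AddSubgroup.mem_addSubgroupOf]) hcyc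

end Selmer

end OddBlindNF

end Summit.BirchSwinnertonDyer.BirchSwinnertonDyer.Theorems

end
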